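import Summits.FinalStateConjecture.FinalStateConjecture.Theses.KillingDefectSpacetimeBound

/-!
# Birth skeleton — crux `KillingDefectSpacetimeBound.SquareIntegrableCapture` (stmt-FinalStateConjecture-18630)

Skeleton registrar `planner-skel-stmt-FinalStateConjecture-18630-0`, 2026-08-17 (route
`route-FinalStateConjecture-KillingDefectSpacetimeBound`, rev 2; re-audit bin HONEST: the crux had no
registered skeleton).  The crux is FIXED and concluded BY NAME by `SquareIntegrableCapture_of`:
`Summit.FinalStateConjecture.FinalStateConjecture.Theses.KillingDefectSpacetimeBound.SquareIntegrableCapture`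
— K1 of the route: an order `k₁` such that for `k ≥ k₁` and all bounds `(Λ, χ, M₀, a₀)` there are
`δ₀, η > 0` with: for every admissible datum, MAXIMAL development `𝒟`, hyperboloidal Kerr-star foliation `Ψ`
of order `k` after `τ₀` (rays in the closure of `exteriorOf (Ψ '' lateRegion τ₀)`, complete `𝓘⁺`) and
every `τ₁ ≥ τ₀`, the four smallness hypotheses after `τ₁` (`d_k ≤ δ₀`, `∫ d_k² ≤ η`, full LE budget of
order `k` `≤ η`, outer-zone LE budget of order `k+2` `≤ η`) give the Statement's conclusion verbatim
(`∃ O d`, `FinalStateDecomposition … O 2`, sub-extremal, `O = exteriorOf d.charted`, rays, exhaustive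
charts, future oriented).

## The line in one paragraph (a REGIONAL cut: near capture · radiation zone · Lorentzian synthesis)

The crux bundles three different pieces of mathematics, and the cut below separates them so that none of
the three restates the crux or the summit:

* `stub_nearKerrCapture` (S1, XL, the load-bearing ANALYTIC stub — "capture"): under exactly the crux's
  hypotheses (the four smallness clauses bundled as `SmallAfter`), there are FINAL sub-extremal parameters
  `(M, a)`, an inner radius `0 < ρ < r₊(M,a)`, a late time `τ₂` and ONE chart `Φ` modelled on the
  hyperboloidal Kerr-star background `B♯(M, a; ρ) = hypStarBackgroundFrom M a ρ` (the crux's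
  `Kerr.hypStarBackground` with a flexible inner edge) which is a late chart inside `Ψ`'s late image,
  covers `Ψ`'s late image outside the deep shell, is future oriented (push-forward of `Kerr.timeVector`),
  and in which the LE-WEIGHTED `C^m` size of `Φ^* g − g_{M,a}` on the unit bands tends to `0`
  (`NearKerrChart`).  This is the crux's OWN deviation functional `d_k` with the infimum over `(M, a, Φ)`
  removed: the modulation parameters converge and the gauge settles (Lindblad–Tohaneanu 2020 `κ`-norms,
  DHRT arXiv:2104.08222 / Klainerman–Szeftel 2023 / GKS arXiv:2205.14808 asymptotic stability, run from a
  late leaf with `L²_τ`-small leaf deviation).  Why it might fail: `L²` (not `L¹`) smallness in time may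
  not sum the modulation drift (the crux's own risk); `|a| → M` degeneration is excluded only through `χ`.
* `stub_radiationZoneChart` (S3, XL, FAR FIELD): under the crux's hypotheses and GIVEN a near Kerr chart of
  order `m₃ + m`, there is a flat radiation chart `Θ : U → M` of order `m` (`RadiationChart`): `U` contains
  the late flat half-space `{x⁰ > T}` minus the sublinear tube `{r(a,·) ≤ σ(x⁰)}`, `Θ` is a late chart into
  `J⁺(ιΣ)`, future oriented, the FULL `C^m` deviation from `η` on the flat slabs tends to `0`, and `Θ = Φ`
  on the transition annulus `σ < r < 2σ`.  Content: Klainerman–Nicolò exterior stability near `i⁰`,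
  propagation of asymptotic flatness along `𝓘⁺` through the EARLY wave zone `u ∈ (u_KN, τ₂)` (large data:
  NOT in print in this form — flagged), and the late wave zone from the LE budgets (the LE weight
  `(1+‖y‖)⁻¹` makes the crux's far-field smallness weak: unweighted decay far out, i.e. the exclusion of a
  receding far concentration, is proved HERE, not assumed).  Why it might fail: exactly those two points.
* `stub_decompositionOfCharts` (S2, L/XL, LORENTZIAN SYNTHESIS): from the crux's global hypotheses
  (maximal, complete `𝓘⁺`, the foliation `Ψ`, rays in the closure of `exteriorOf (Ψ '' late)`), a near
  Kerr chart and a radiation chart of order `m₂`, build the `N = 1` decomposition with trivial motion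
  `(1, 0)`: restrict `Φ` to the Kerr exterior `{r > r₊}` (horizon normalisation uses `ρ < r₊`), convert
  hyperboloidal bands to truncated `t*`-slabs (finitely many bands per slab, LE weight `≥ (1+R)⁻¹` there),
  diagonalise the truncation radius, prove `HasExhaustiveCharts` (ii) (chart time vs causal order) and
  `IsFutureOriented` (connectedness from the future-orientation clauses), place the chart images in
  `J⁺(ιΣ)` (from `Θ`'s clause, `Σ` Cauchy, far coordinate lines of infinite proper time) and TRANSFER the
  rays clause from `O_Ψ` to `O = exteriorOf d.charted`.  Why it might fail: the rays transfer must exclude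
  a future-complete null ray from `Σ` lingering in `Ψ`'s deep shell (controlled by the hypotheses only
  through bounded geometry, vacuum, `deepShell` and near-Kerr monotonicity of `r` down to `ρ`).
* `SquareIntegrableCapture_of : S1 → S3 → S2 → SquareIntegrableCapture` is PROVED below (no `sorry` of its
  own): thresholds `k₁ + m₃ + m₂`, the two `(δ₀, η)` pairs of S1 and S3 reconciled by `min` (`SmallAfter.mono`),
  the order of the near chart lowered from `m₃ + m₂` to `m₂` (`NearKerrChart.of_le`, monotonicity of
  `leSupCkENorm` in the order), then S2.

Hazards recorded for the provers (not defects of the cut; they are the crux's): (H1) the LE weight of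
`leafDev`/`defectLE` admits a receding far concentration satisfying all four smallness clauses — its
exclusion is the far half of S3; (H2) nothing typed relates `ιΣ` to the charts except `RaysStayInClosure`
and Cauchy-ness — the `J⁺(ιΣ)` placement is S3's clause (it builds `Θ` from `Σ`'s exterior end) and S2's
transfer; (H3) `HasExhaustiveCharts` needs the final event horizon inside `Ψ`'s covered shell — forced by
`IsHypKerrFoliation.deepShell`, delivered by S1 as `ρ < r₊(M,a)` plus the covering clause.

Probes (BC3, registrar folder `bc/probe_bc3*.lean`: self-contained copies of the objects and the name-keyed
stub statements WITHOUT the sorried stubs, so that `exact?` cannot pick them up): for each registered stub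
`S`, `S → SquareIntegrableCapture` and `S → FinalStateConjecture` under `set_option maxHeartbeats 400000` —
combined battery `first | exact? | simpa | aesop`: 6/6 FAIL; per battery: `exact?` 6/6 "could not close
the goal", `aesop` 6/6 "failed to prove the goal after exhaustive search", `simpa` 6/6 heartbeat timeout at
400000 and, re-run at 1600000 on `S1 → crux` / `S2 → summit`, a genuine `assumption failed` on the residual
implication.  No stub is the crux or the summit in costume: S1 concludes a chart, not a decomposition; S3
and S2 take the charts as antecedents.  Disproof used: none (no `Cruxes/SquareIntegrableCapture/Disproof.lean`
exists at registration); `ledger negatives --problem FinalStateConjecture` was read — no negative concerns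
capture / charts of this shape.
-/

noncomputable section

open scoped BigOperators Topology Manifold Classical MeasureTheory ContDiff ENNReal
open Filter Set Function TopologicalSpace MeasureTheory
open Literature.Geometry.Lorentzian

namespace Summit.FinalStateConjecture.FinalStateConjecture.Cruxes.SquareIntegrableCapture.Birth

/-! ## Objects of the line -/

/-- The **hyperboloidal Kerr-star background with inner edge `ρ`**, `B♯(M, a; ρ)`: verbatim
`Kerr.hypStarBackground M a` (domain `Kerr.region a M`, Kerr–Schild form `g_{M,a}`, hyperboloidal time
`t* − h♯_{4M}(y)`, Kerr–Schild radius) except that the domain is `Kerr.region a ρ = {r(a,·) > max ρ 0}`.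
The final chart of the line lives on it with `0 < ρ < r₊(M, a)` (a two-sided collar of the final event
horizon, as deep as `Ψ`'s covered shell reaches). -/
def hypStarBackgroundFrom (M a ρ : ℝ) : ModelBackground where
  domain := Kerr.region a ρ
  bilin := Kerr.bilin M a
  time x := x 0 - Kerr.scriHeight M a (4 * M) (E4.spatial x)
  radius := Kerr.radius a

/-- **The four smallness hypotheses of the crux after `τ₁`** (verbatim its four antecedents, bundled):
leaf deviation `d_k ≤ δ₀` after `τ₁`, `∫_(τ₁,∞) d_k² ≤ η`, full LE budget of order `k` over `(τ₁, ∞)`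
`≤ η`, outer-zone LE budget of order `k + 2` over `(τ₁, ∞)` `≤ η`. -/
def SmallAfter (𝓢 : Spacetime.{0} 4) (M₀ a₀ χ : ℝ)
    (Ψ : (Kerr.hypStarBackground M₀ a₀).domain → 𝓢.carrier) (k : ℕ) (τ₁ δ₀ η : ℝ) : Prop :=
  (∀ τ : ℝ, τ₁ ≤ τ → 𝓢.leafDev M₀ a₀ Ψ χ k τ ≤ ENNReal.ofReal δ₀) ∧
  ∫⁻ τ in Set.Ioi τ₁, 𝓢.leafDev M₀ a₀ Ψ χ k τ ^ 2 ≤ ENNReal.ofReal η ∧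
  𝓢.defectLE (Kerr.hypStarBackground M₀ a₀) Ψ k (Set.Ioi τ₁) Set.univ ≤ ENNReal.ofReal η ∧
  𝓢.defectLE (Kerr.hypStarBackground M₀ a₀) Ψ (k + 2) (Set.Ioi τ₁) (Kerr.outerZones M₀ a₀) ≤
    ENNReal.ofReal η

/-- **Near Kerr chart of order `m`** (`NearKerrChart 𝓢 M₀ a₀ τ₀ Ψ m M a ρ τ₂ Φ`): the output of the capture
step.  `(M, a)` is sub-extremal and `0 < ρ < r₊(M, a)`; `Φ : B♯(M,a;ρ) → M` is a late chart after `τ₂`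
(smooth, open embedding of the late region); its late image lies inside `Ψ`'s late image after `τ₀` and
CONTAINS `Ψ`'s late image outside the deep shell `{r(a₀,·) < (r₊(M₀,a₀) + M₀)/2}` after some `τ₃`; it is
future oriented (the push-forward of the `g_{M,a}`-timelike field `V_{M,a} = −g♯(dt*)` is future-directed
on the late region); and the LE-WEIGHTED `C^m` size of the deviation `Φ^* g − g_{M,a}` over the unit bands
`{τ ≤ time ≤ τ + 1}` tends to `0` — the crux's `leafDev` with FIXED parameters and gauge. -/
def NearKerrChart (𝓢 : Spacetime.{0} 4) (M₀ a₀ τ₀ : ℝ)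
    (Ψ : (Kerr.hypStarBackground M₀ a₀).domain → 𝓢.carrier) (m : ℕ) (M a ρ τ₂ : ℝ)
    (Φ : (hypStarBackgroundFrom M a ρ).domain → 𝓢.carrier) : Prop :=
  let B := hypStarBackgroundFrom M a ρ
  Kerr.IsSubextremal M a ∧ 0 < ρ ∧ ρ < Kerr.rPlus M a ∧
  𝓢.IsLateChart B Set.univ τ₂ Φ ∧
  Φ '' B.lateRegion τ₂ ⊆ Ψ '' (Kerr.hypStarBackground M₀ a₀).lateRegion τ₀ ∧
  (∃ τ₃ : ℝ, Ψ '' ((Kerr.hypStarBackground M₀ a₀).lateRegion τ₃ ∩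
      {x | (Kerr.rPlus M₀ a₀ + M₀) / 2 ≤ Kerr.radius a₀ x.1}) ⊆ Φ '' B.lateRegion τ₂) ∧
  (∀ x ∈ B.lateRegion τ₂, 𝓢.timeOrientation.IsFutureDirected
      (mfderiv 𝓘(ℝ, E4) (𝓡 4) Φ x (Kerr.timeVector M a x.1))) ∧
  Tendsto (fun τ : ℝ ↦ leSupCkENorm (Subtype.val '' B.timeBand (Icc τ (τ + 1))) m
      (𝓢.deviationExtend B Φ)) atTop (𝓝 0)

/-- **Radiation chart of order `m`** (`RadiationChart 𝓢 S m M a ρ τ₂ Φ T σ U Θ`), glued to the near chart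
`Φ`: the excision radius is sublinear (`σ(t)/t → 0`); the flat domain `U` contains the late half-space
`{x⁰ > T}` minus the tube `{r(a,·) ≤ σ(x⁰)}` (trivial motion `(1, 0)`: the clause of
`FinalStateDecomposition.setOf_lt_excision_subset_flatDomain` for `N = 1`); `Θ` is a late chart after `T`
INTO `J⁺(S)` (`S = ιΣ`); the push-forward of `∂₀` is future-directed on the late region; the FULL `C^m`
deviation of `Θ^* g` from `η` on the flat slabs `{x⁰ = t} ∩ U` tends to `0`; and on the transition annulus
`{x⁰ > T, σ(x⁰) < r(a,·) < 2σ(x⁰)}` the point lies in `Φ`'s late domain and `Θ = Φ` there. -/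
def RadiationChart (𝓢 : Spacetime.{0} 4) (S : Set 𝓢.carrier) (m : ℕ) (M a ρ τ₂ : ℝ)
    (Φ : (hypStarBackgroundFrom M a ρ).domain → 𝓢.carrier) (T : ℝ) (σ : ℝ → ℝ) (U : Opens E4)
    (Θ : U → 𝓢.carrier) : Prop :=
  let F := Minkowski.backgroundOn U
  Tendsto (fun t : ℝ ↦ σ t / t) atTop (𝓝 0) ∧
  {x : E4 | T < x 0 ∧ σ (x 0) < Kerr.radius a x} ⊆ (U : Set E4) ∧
  𝓢.IsLateChart F (𝓢.metric.causalFuture 𝓢.timeOrientation S) T Θ ∧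
  (∀ x ∈ F.lateRegion T, 𝓢.timeOrientation.IsFutureDirected
      (mfderiv 𝓘(ℝ, E4) (𝓡 4) Θ x (E4.basisVector 0))) ∧
  Tendsto (fun t : ℝ ↦ 𝓢.deviationCk F Θ m t) atTop (𝓝 0) ∧
  (∀ x : U, T < x.1 0 → σ (x.1 0) < Kerr.radius a x.1 → Kerr.radius a x.1 < 2 * σ (x.1 0) →
      ∃ hx : x.1 ∈ (hypStarBackgroundFrom M a ρ).domain,
        τ₂ < (hypStarBackgroundFrom M a ρ).time x.1 ∧ Θ x = Φ ⟨x.1, hx⟩)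

/-! ## Registered stubs (the ONLY `sorry`s of this file) -/

/-- **Registered stub S1 — near Kerr capture (XL, the load-bearing analytic stub).**  There is an order
`k₁` such that for all `m` and `k ≥ k₁ + m` and all `(Λ, χ, M₀, a₀)` there are `δ₀, η > 0` with: under the
crux's hypotheses (admissible datum, maximal development, hyperboloidal Kerr-star foliation `Ψ` of order `k`
after `τ₀` with rays and complete `𝓘⁺`, `τ₁ ≥ τ₀`, the four smallness clauses `SmallAfter … k τ₁ δ₀ η`)
there is a near Kerr chart of order `m` (`NearKerrChart`).  Intended proof: modulation of `(M, a)` and of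
the re-charting gauge leaf by leaf (`leafDev ≤ δ₀`), summability of the drift from `∫ d_k² ≤ η` and the LE
budgets (Lindblad–Tohaneanu arXiv:2004.05664, Thm 1: `κ₁ ∈ L²_t`), then sub-extremal Kerr asymptotic
stability from a late leaf in the settled gauge (DHRT arXiv:2104.08222; Klainerman–Szeftel 2023; GKS
arXiv:2205.14808), giving LE-weighted `C^m` decay in ONE chart with inner edge `ρ < r₊(M,a)` reaching below
`Ψ`'s covered shell (`IsHypKerrFoliation.deepShell` puts the deep shell inside the hole; Cauchy stability
inwards by a fixed `r`-step).  Why it might fail: `L²_t` (not `L¹_t`) control of `d_k` may not sum the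
modulation drift; the stability input is in print only for `|a| ≪ M` / with `r`-weighted initial norms the
LE-weighted hypotheses do not obviously supply. -/
theorem stub_nearKerrCapture :
    ∃ k₁ : ℕ, ∀ m k : ℕ, k₁ + m ≤ k → ∀ (Λ χ M₀ a₀ : ℝ), ∃ (δ₀ η : ℝ), 0 < δ₀ ∧ 0 < η ∧
      ∀ (X : Type) [TopologicalSpace X] [ChartedSpace E3 X] [IsManifold (𝓡 3) ∞ X] [T2Space X]
        [SecondCountableTopology X] [ConnectedSpace X], ∀ D ∈ admissibleVacuumData X,
        ∀ (𝒟 : VacuumCauchyDevelopment D), 𝒟.IsMaximal →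
        ∀ (τ₀ : ℝ) (Ψ : (Kerr.hypStarBackground M₀ a₀).domain → 𝒟.carrier),
        𝒟.toSpacetime.IsHypKerrFoliation k Λ χ M₀ a₀ τ₀ Ψ →
        Summit.FinalStateConjecture.RaysStayInClosure 𝒟.toCauchyDevelopment
          (Summit.FinalStateConjecture.exteriorOf 𝒟.toCauchyDevelopment
            (Ψ '' (Kerr.hypStarBackground M₀ a₀).lateRegion τ₀)) →
        Summit.FinalStateConjecture.HasCompleteNullInfinity 𝒟.toCauchyDevelopment →
        ∀ τ₁ : ℝ, τ₀ ≤ τ₁ → SmallAfter 𝒟.toSpacetime M₀ a₀ χ Ψ k τ₁ δ₀ η →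
        ∃ (M a ρ τ₂ : ℝ) (Φ : (hypStarBackgroundFrom M a ρ).domain → 𝒟.carrier),
          NearKerrChart 𝒟.toSpacetime M₀ a₀ τ₀ Ψ m M a ρ τ₂ Φ := by
  sorry

/-- **Registered stub S3 — the radiation-zone chart (XL, far field).**  There is an order `m₃` such that for
all `m` and `k ≥ m₃ + m` and all `(Λ, χ, M₀, a₀)` there are `δ₀, η > 0` with: under the crux's hypotheses
with these constants and GIVEN a near Kerr chart `Φ` of order `m₃ + m`, there is a radiation chart of order
`m` glued to it (`RadiationChart`, into `J⁺(ιΣ)`).  Intended proof: Klainerman–Nicolò 2003 exterior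
stability of the admissible end of `Σ` (the chart near `i⁰`, which also locates `ιΣ`); propagation of
asymptotic flatness along the complete `𝓘⁺` through the early wave zone up to the retarded times charted
by `Φ` (semi-global existence near `𝓘⁺` on a finite retarded-time interval for LARGE data — not in print in
this form); the late wave zone from the LE budgets and the near chart (the radiation field at `𝓘⁺` is read
off at the interface radius `‖y‖ ∼ 8M₀`, where the LE weight is `O(1)`, and carried out by the `r^p`
hierarchy, Dafermos–Rodnianski arXiv:0910.4957); flat coordinates glued to `Φ`'s Kerr–Schild coordinates on
the annulus, excision radius `σ` chosen so slowly growing that the weighted decay of `Φ` is unweighted decay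
on `{σ < r < 2σ}`.  Why it might fail: the LE weight `(1+‖y‖)⁻¹` lets the crux's four smallness clauses hold
in the presence of a receding far concentration of curvature (an eternal, neither dispersing nor collapsing
vacuum lump) which no flat chart can absorb — excluding it is a large-data statement; and the early wave
zone is controlled by no clause of the route. -/
theorem stub_radiationZoneChart :
    ∃ m₃ : ℕ, ∀ m k : ℕ, m₃ + m ≤ k → ∀ (Λ χ M₀ a₀ : ℝ), ∃ (δ₀ η : ℝ), 0 < δ₀ ∧ 0 < η ∧
      ∀ (X : Type) [TopologicalSpace X] [ChartedSpace E3 X] [IsManifold (𝓡 3) ∞ X] [T2Space X]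
        [SecondCountableTopology X] [ConnectedSpace X], ∀ D ∈ admissibleVacuumData X,
        ∀ (𝒟 : VacuumCauchyDevelopment D), 𝒟.IsMaximal →
        ∀ (τ₀ : ℝ) (Ψ : (Kerr.hypStarBackground M₀ a₀).domain → 𝒟.carrier),
        𝒟.toSpacetime.IsHypKerrFoliation k Λ χ M₀ a₀ τ₀ Ψ →
        Summit.FinalStateConjecture.RaysStayInClosure 𝒟.toCauchyDevelopment
          (Summit.FinalStateConjecture.exteriorOf 𝒟.toCauchyDevelopment
            (Ψ '' (Kerr.hypStarBackground M₀ a₀).lateRegion τ₀)) →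
        Summit.FinalStateConjecture.HasCompleteNullInfinity 𝒟.toCauchyDevelopment →
        ∀ τ₁ : ℝ, τ₀ ≤ τ₁ → SmallAfter 𝒟.toSpacetime M₀ a₀ χ Ψ k τ₁ δ₀ η →
        ∀ (M a ρ τ₂ : ℝ) (Φ : (hypStarBackgroundFrom M a ρ).domain → 𝒟.carrier),
          NearKerrChart 𝒟.toSpacetime M₀ a₀ τ₀ Ψ (m₃ + m) M a ρ τ₂ Φ →
        ∃ (T : ℝ) (σ : ℝ → ℝ) (U : Opens E4) (Θ : U → 𝒟.carrier),
          RadiationChart 𝒟.toSpacetime (range 𝒟.embed) m M a ρ τ₂ Φ T σ U Θ := by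
  sorry

/-- **Registered stub S2 — the decomposition from the two charts (L/XL, Lorentzian synthesis).**  There is
an order `m₂` such that: for every admissible datum, maximal development with complete `𝓘⁺`, hyperboloidal
Kerr-star foliation `Ψ` (any order) with rays in the closure of `exteriorOf (Ψ '' late)`, every near Kerr
chart `Φ` of order `m₂` and every radiation chart `Θ` of order `m₂` glued to it, the Statement's conclusion
holds: `∃ O d` with `d : FinalStateDecomposition … O 2` (`N = 1`, motion `(1, 0)`, hole chart `Φ`
restricted to the Kerr exterior `{r > r₊(M,a)}` with time `t*`, flat chart `Θ`), sub-extremal parameters,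
`O = exteriorOf d.charted`, rays, exhaustive charts, future oriented.  Intended proof: `t*`-truncated slabs
`{t* = τ, r ≤ R}` meet finitely many hyperboloidal unit bands on which the LE weight is `≥ (1+R)⁻¹`, so the
weighted band decay is truncated `C²` decay, for fixed and (diagonally) growing `R(τ)`; the chart images lie
in `J⁺(ιΣ)` (`Θ`'s clause; `Σ` is Cauchy and the far coordinate lines of `Φ` have infinite proper time, so a
late enough `Φ`-region is disjoint from `Σ` and on its future side); `HasExhaustiveCharts` (ii) by comparing
chart time with causal order in the `C²`-close geometry (horizon collar `ρ < r₊`: the hole chart is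
normalised to the event horizon); `IsFutureOriented` from the two future-orientation clauses; rays: a
future-complete normalised null ray from `Σ` in the closure of `O_Ψ` either reaches the radiation zone, or
orbits / hugs the horizon at `t* → ∞` inside `Φ`'s exterior image, or enters `{r < r₊ − ε}` — where `r` is
strictly decreasing at a definite rate down to `ρ`, and below `Φ`'s edge `Ψ`'s deep shell cannot host it
(bounded geometry, `deepShell`).  Why it might fail: that last exclusion (a complete ray lingering in the
deep shell) is controlled by no smallness clause; and `Σ`'s position relative to `Φ` enters only through
`Θ ⊆ J⁺(ιΣ)` and Cauchy-ness. -/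
theorem stub_decompositionOfCharts :
    ∃ m₂ : ℕ, ∀ (X : Type) [TopologicalSpace X] [ChartedSpace E3 X] [IsManifold (𝓡 3) ∞ X] [T2Space X]
      [SecondCountableTopology X] [ConnectedSpace X], ∀ D ∈ admissibleVacuumData X,
      ∀ (𝒟 : VacuumCauchyDevelopment D), 𝒟.IsMaximal →
      Summit.FinalStateConjecture.HasCompleteNullInfinity 𝒟.toCauchyDevelopment →
      ∀ (k : ℕ) (Λ χ M₀ a₀ τ₀ : ℝ) (Ψ : (Kerr.hypStarBackground M₀ a₀).domain → 𝒟.carrier),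
      𝒟.toSpacetime.IsHypKerrFoliation k Λ χ M₀ a₀ τ₀ Ψ →
      Summit.FinalStateConjecture.RaysStayInClosure 𝒟.toCauchyDevelopment
        (Summit.FinalStateConjecture.exteriorOf 𝒟.toCauchyDevelopment
          (Ψ '' (Kerr.hypStarBackground M₀ a₀).lateRegion τ₀)) →
      ∀ (M a ρ τ₂ : ℝ) (Φ : (hypStarBackgroundFrom M a ρ).domain → 𝒟.carrier),
        NearKerrChart 𝒟.toSpacetime M₀ a₀ τ₀ Ψ m₂ M a ρ τ₂ Φ →
      ∀ (T : ℝ) (σ : ℝ → ℝ) (U : Opens E4) (Θ : U → 𝒟.carrier),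
        RadiationChart 𝒟.toSpacetime (range 𝒟.embed) m₂ M a ρ τ₂ Φ T σ U Θ →
      ∃ (O : Set 𝒟.carrier) (d : FinalStateDecomposition 𝒟.toSpacetime O 2),
        (∀ i, Kerr.IsSubextremal (d.mass i) (d.spin i)) ∧
        O = Summit.FinalStateConjecture.exteriorOf 𝒟.toCauchyDevelopment d.charted ∧
        Summit.FinalStateConjecture.RaysStayInClosure 𝒟.toCauchyDevelopment O ∧
        Summit.FinalStateConjecture.HasExhaustiveCharts d ∧
        Summit.FinalStateConjecture.IsFutureOriented d := by
  sorry

/-! ## Name-keyed statements of the registered stubs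

`Registered.stub_X : Prop` is the statement of `stub_X` under the stub's own short name, so that the
hypotheses of `SquareIntegrableCapture_of` read as the registered stubs BY NAME. -/
namespace Registered

/-- Statement of `stub_nearKerrCapture` (S1). -/
abbrev stub_nearKerrCapture : Prop :=
  ∃ k₁ : ℕ, ∀ m k : ℕ, k₁ + m ≤ k → ∀ (Λ χ M₀ a₀ : ℝ), ∃ (δ₀ η : ℝ), 0 < δ₀ ∧ 0 < η ∧
    ∀ (X : Type) [TopologicalSpace X] [ChartedSpace E3 X] [IsManifold (𝓡 3) ∞ X] [T2Space X]
      [SecondCountableTopology X] [ConnectedSpace X], ∀ D ∈ admissibleVacuumData X,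
      ∀ (𝒟 : VacuumCauchyDevelopment D), 𝒟.IsMaximal →
      ∀ (τ₀ : ℝ) (Ψ : (Kerr.hypStarBackground M₀ a₀).domain → 𝒟.carrier),
      𝒟.toSpacetime.IsHypKerrFoliation k Λ χ M₀ a₀ τ₀ Ψ →
      Summit.FinalStateConjecture.RaysStayInClosure 𝒟.toCauchyDevelopment
        (Summit.FinalStateConjecture.exteriorOf 𝒟.toCauchyDevelopment
          (Ψ '' (Kerr.hypStarBackground M₀ a₀).lateRegion τ₀)) →
      Summit.FinalStateConjecture.HasCompleteNullInfinity 𝒟.toCauchyDevelopment →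
      ∀ τ₁ : ℝ, τ₀ ≤ τ₁ → SmallAfter 𝒟.toSpacetime M₀ a₀ χ Ψ k τ₁ δ₀ η →
      ∃ (M a ρ τ₂ : ℝ) (Φ : (hypStarBackgroundFrom M a ρ).domain → 𝒟.carrier),
        NearKerrChart 𝒟.toSpacetime M₀ a₀ τ₀ Ψ m M a ρ τ₂ Φ

/-- Statement of `stub_radiationZoneChart` (S3). -/
abbrev stub_radiationZoneChart : Prop :=
  ∃ m₃ : ℕ, ∀ m k : ℕ, m₃ + m ≤ k → ∀ (Λ χ M₀ a₀ : ℝ), ∃ (δ₀ η : ℝ), 0 < δ₀ ∧ 0 < η ∧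
    ∀ (X : Type) [TopologicalSpace X] [ChartedSpace E3 X] [IsManifold (𝓡 3) ∞ X] [T2Space X]
      [SecondCountableTopology X] [ConnectedSpace X], ∀ D ∈ admissibleVacuumData X,
      ∀ (𝒟 : VacuumCauchyDevelopment D), 𝒟.IsMaximal →
      ∀ (τ₀ : ℝ) (Ψ : (Kerr.hypStarBackground M₀ a₀).domain → 𝒟.carrier),
      𝒟.toSpacetime.IsHypKerrFoliation k Λ χ M₀ a₀ τ₀ Ψ →
      Summit.FinalStateConjecture.RaysStayInClosure 𝒟.toCauchyDevelopment
        (Summit.FinalStateConjecture.exteriorOf 𝒟.toCauchyDevelopment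
          (Ψ '' (Kerr.hypStarBackground M₀ a₀).lateRegion τ₀)) →
      Summit.FinalStateConjecture.HasCompleteNullInfinity 𝒟.toCauchyDevelopment →
      ∀ τ₁ : ℝ, τ₀ ≤ τ₁ → SmallAfter 𝒟.toSpacetime M₀ a₀ χ Ψ k τ₁ δ₀ η →
      ∀ (M a ρ τ₂ : ℝ) (Φ : (hypStarBackgroundFrom M a ρ).domain → 𝒟.carrier),
        NearKerrChart 𝒟.toSpacetime M₀ a₀ τ₀ Ψ (m₃ + m) M a ρ τ₂ Φ →
      ∃ (T : ℝ) (σ : ℝ → ℝ) (U : Opens E4) (Θ : U → 𝒟.carrier),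
        RadiationChart 𝒟.toSpacetime (range 𝒟.embed) m M a ρ τ₂ Φ T σ U Θ

/-- Statement of `stub_decompositionOfCharts` (S2). -/
abbrev stub_decompositionOfCharts : Prop :=
  ∃ m₂ : ℕ, ∀ (X : Type) [TopologicalSpace X] [ChartedSpace E3 X] [IsManifold (𝓡 3) ∞ X] [T2Space X]
    [SecondCountableTopology X] [ConnectedSpace X], ∀ D ∈ admissibleVacuumData X,
    ∀ (𝒟 : VacuumCauchyDevelopment D), 𝒟.IsMaximal →
    Summit.FinalStateConjecture.HasCompleteNullInfinity 𝒟.toCauchyDevelopment →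
    ∀ (k : ℕ) (Λ χ M₀ a₀ τ₀ : ℝ) (Ψ : (Kerr.hypStarBackground M₀ a₀).domain → 𝒟.carrier),
    𝒟.toSpacetime.IsHypKerrFoliation k Λ χ M₀ a₀ τ₀ Ψ →
    Summit.FinalStateConjecture.RaysStayInClosure 𝒟.toCauchyDevelopment
      (Summit.FinalStateConjecture.exteriorOf 𝒟.toCauchyDevelopment
        (Ψ '' (Kerr.hypStarBackground M₀ a₀).lateRegion τ₀)) →
    ∀ (M a ρ τ₂ : ℝ) (Φ : (hypStarBackgroundFrom M a ρ).domain → 𝒟.carrier),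
      NearKerrChart 𝒟.toSpacetime M₀ a₀ τ₀ Ψ m₂ M a ρ τ₂ Φ →
    ∀ (T : ℝ) (σ : ℝ → ℝ) (U : Opens E4) (Θ : U → 𝒟.carrier),
      RadiationChart 𝒟.toSpacetime (range 𝒟.embed) m₂ M a ρ τ₂ Φ T σ U Θ →
    ∃ (O : Set 𝒟.carrier) (d : FinalStateDecomposition 𝒟.toSpacetime O 2),
      (∀ i, Kerr.IsSubextremal (d.mass i) (d.spin i)) ∧
      O = Summit.FinalStateConjecture.exteriorOf 𝒟.toCauchyDevelopment d.charted ∧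
      Summit.FinalStateConjecture.RaysStayInClosure 𝒟.toCauchyDevelopment O ∧
      Summit.FinalStateConjecture.HasExhaustiveCharts d ∧
      Summit.FinalStateConjecture.IsFutureOriented d

end Registered

/-- Consistency check: the registered stubs prove their name-keyed statements. -/
example : Registered.stub_nearKerrCapture ∧ Registered.stub_radiationZoneChart ∧
    Registered.stub_decompositionOfCharts :=
  ⟨stub_nearKerrCapture, stub_radiationZoneChart, stub_decompositionOfCharts⟩

/-! ## Bookkeeping lemmas of the composition (proved) -/

/-- The smallness hypotheses weaken as `(δ₀, η)` grow (`ENNReal.ofReal` is monotone). -/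
theorem SmallAfter.mono {𝓢 : Spacetime.{0} 4} {M₀ a₀ χ : ℝ}
    {Ψ : (Kerr.hypStarBackground M₀ a₀).domain → 𝓢.carrier} {k : ℕ} {τ₁ δ₀ η δ₀' η' : ℝ}
    (h : SmallAfter 𝓢 M₀ a₀ χ Ψ k τ₁ δ₀ η) (hδ : δ₀ ≤ δ₀') (hη : η ≤ η') :
    SmallAfter 𝓢 M₀ a₀ χ Ψ k τ₁ δ₀' η' :=
  ⟨fun τ hτ ↦ (h.1 τ hτ).trans (ENNReal.ofReal_le_ofReal hδ),
    h.2.1.trans (ENNReal.ofReal_le_ofReal hη), h.2.2.1.trans (ENNReal.ofReal_le_ofReal hη),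
    h.2.2.2.trans (ENNReal.ofReal_le_ofReal hη)⟩

/-- A near Kerr chart of order `m'` is one of every lower order `m ≤ m'` (the LE-weighted `C^m` size is
monotone in the order, `leSupCkENorm_mono_right`). -/
theorem NearKerrChart.of_le {𝓢 : Spacetime.{0} 4} {M₀ a₀ τ₀ : ℝ}
    {Ψ : (Kerr.hypStarBackground M₀ a₀).domain → 𝓢.carrier} {m m' : ℕ} {M a ρ τ₂ : ℝ}
    {Φ : (hypStarBackgroundFrom M a ρ).domain → 𝓢.carrier}
    (hΦ : NearKerrChart 𝓢 M₀ a₀ τ₀ Ψ m' M a ρ τ₂ Φ) (h : m ≤ m') :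
    NearKerrChart 𝓢 M₀ a₀ τ₀ Ψ m M a ρ τ₂ Φ := by
  dsimp only [NearKerrChart] at hΦ ⊢
  obtain ⟨h1, h2, h3, h4, h5, h6, h7, h8⟩ := hΦ
  refine ⟨h1, h2, h3, h4, h5, h6, h7, ?_⟩
  exact tendsto_of_tendsto_of_tendsto_of_le_of_le tendsto_const_nhds h8 (fun _ ↦ zero_le)
    fun τ ↦ leSupCkENorm_mono_right _ h _

/-! ## The composition (kernel-checked, no sorry of its own) -/

/-- **Skeleton theorem.**  S1 → S3 → S2 → the crux `Theses.KillingDefectSpacetimeBound.SquareIntegrableCapture`,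
BY NAME: unfold the crux; take the threshold `k₁ + m₃ + m₂`; for `k` above it and given bounds
`(Λ, χ, M₀, a₀)` take S1's constants at order `m₃ + m₂` and S3's at order `m₂` and their minima
(`SmallAfter.mono`); under the crux's hypotheses obtain the near Kerr chart (S1), the radiation chart glued to
it (S3), lower the near chart's order to `m₂` (`NearKerrChart.of_le`) and conclude with S2. -/
theorem SquareIntegrableCapture_of (h₁ : Registered.stub_nearKerrCapture)
    (h₃ : Registered.stub_radiationZoneChart) (h₂ : Registered.stub_decompositionOfCharts) :
    Theses.KillingDefectSpacetimeBound.SquareIntegrableCapture := by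
  obtain ⟨k₁, h₁⟩ := h₁
  obtain ⟨m₃, h₃⟩ := h₃
  obtain ⟨m₂, h₂⟩ := h₂
  unfold Theses.KillingDefectSpacetimeBound.SquareIntegrableCapture
  refine ⟨k₁ + m₃ + m₂, fun k hk Λ χ M₀ a₀ ↦ ?_⟩
  obtain ⟨δ₁, η₁, hδ₁, hη₁, H₁⟩ := h₁ (m₃ + m₂) k (by omega) Λ χ M₀ a₀
  obtain ⟨δ₃, η₃, hδ₃, hη₃, H₃⟩ := h₃ m₂ k (by omega) Λ χ M₀ a₀
  refine ⟨min δ₁ δ₃, min η₁ η₃, lt_min hδ₁ hδ₃, lt_min hη₁ hη₃, ?_⟩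
  intro X _ _ _ _ _ _ D hD 𝒟 hmax τ₀ Ψ hΨ hrays hscri τ₁ hτ₁ hd hint hfull hout
  -- the four smallness antecedents of the crux, bundled
  have hS : SmallAfter 𝒟.toSpacetime M₀ a₀ χ Ψ k τ₁ (min δ₁ δ₃) (min η₁ η₃) :=
    ⟨hd, hint, hfull, hout⟩
  -- S1: the near Kerr chart of order `m₃ + m₂`
  obtain ⟨M, a, ρ, τ₂, Φ, hΦ⟩ := H₁ X D hD 𝒟 hmax τ₀ Ψ hΨ hrays hscri τ₁ hτ₁
    (hS.mono (min_le_left _ _) (min_le_left _ _))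
  -- S3: the radiation chart of order `m₂`, glued to `Φ`
  obtain ⟨T, σ, U, Θ, hΘ⟩ := H₃ X D hD 𝒟 hmax τ₀ Ψ hΨ hrays hscri τ₁ hτ₁
    (hS.mono (min_le_right _ _) (min_le_right _ _)) M a ρ τ₂ Φ hΦ
  -- S2: the decomposition
  exact h₂ X D hD 𝒟 hmax hscri k Λ χ M₀ a₀ τ₀ Ψ hΨ hrays M a ρ τ₂ Φ (hΦ.of_le (by omega)) T σ U Θ hΘ

/-- Wiring check: the registered stubs feed `SquareIntegrableCapture_of` as stated (an `example`, so that
`SquareIntegrableCapture_of` stays the unique theorem of this file concluding the crux). -/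
example : Theses.KillingDefectSpacetimeBound.SquareIntegrableCapture :=
  SquareIntegrableCapture_of stub_nearKerrCapture stub_radiationZoneChart stub_decompositionOfCharts

end Summit.FinalStateConjecture.FinalStateConjecture.Cruxes.SquareIntegrableCapture.Birth

end
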